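import Literature.Geometry.Riemannian.NeckScaling
import Literature.Geometry.Riemannian.CkNecks
import Literature.Geometry.Lorentzian.CurvatureContinuity
import Literature.Geometry.Lorentzian.LeviCivitaProofs
import HarnessLib

/-!
# `ε`-caps in the `C^{[1/ε]}` topology (Chen–Zhu 2006, §4, p. 24)
(topic `Geometry/Riemannian`)

The **faithful, `C^k` form** of Chen–Zhu's `ε`-caps, the sibling of the `C⁰` notion `IsEpsCap` of
`CanonicalNeighbourhoods.lean` obtained by replacing the `C⁰` necks `IsEpsNeck` (`Necks.lean` /
`EvolvingNecks.lean`) by the `C^{[ε⁻¹]}` necks `IsCkEpsNeck` of `CkNecks.lean`.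
Chen–Zhu (J. Differential Geom. 74 (2006), §4, arXiv:math/0504478 p. 24): "Recall that an
`ε`-neck (of radius `r`) is an open set with a Riemannian metric, which is, after scaling the
metric with factor `r⁻²`, `ε`-close (in `C^{[ε⁻¹]}` topology) to the standard neck `S³ × 𝕀` with
the product metric, where `S³` has constant scalar curvature one and `𝕀` has length `2ε⁻¹`. …
A metric on `𝔹⁴` or `ℝℙ⁴ ∖ 𝔹̄⁴`, such that each point outside some compact subset is contained in
an `ε`-neck, is called an `ε`-cap or a capped `ε`-horn, if the scalar curvature stays bounded or
tends to infinity on the end, respectively."  This is alternative (b) of the canonical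
neighbourhood assumption of §5 (p. 26) and of Thm. 4.1 (p. 19) at PRINTED strength (the tree's
`HasCanonicalNeighbourhood` / `chenZhu_canonicalNeighbourhoodTheorem` use the `C⁰` cap).

## Contents

* `IsCkEpsCap g cov B ε` — **`B` is an `ε`-cap of `(M⁴, g)` in the `C^{[1/ε]}` topology**: the
  open `B ⊆ M` is diffeomorphic to `𝔹⁴` (`openBall 4`) or to `ℝℙ⁴ ∖ 𝔹̄⁴`
  (`puncturedRealProjectiveSpace 4`); off some compact `K ⊆ B` every point of `B` lies in an
  `ε`-neck `N ⊆ B` of `(M, g)` in the `C^{[ε⁻¹]}` topology (`IsCkEpsNeck 3 g N ε r`, some radius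
  `r > 0`); and the scalar curvature `R = scalarCurvatureWith g cov` of the pair `(g, cov)` (`cov`
  a Levi-Civita witness, as in the Ricci-flow layer) is bounded on `B`. Same signature as
  `IsEpsCap`.
* The model caps are not compact (`not_isCompact_unitBall`, `not_compactSpace_openBall`,
  `not_isCompact_coe_puncturedRealProjectiveSpace`, `not_compactSpace_puncturedRealProjectiveSpace`),
  hence neither is an `ε`-cap (`IsCkEpsCap.not_compactSpace`, `.not_isCompact`), so **every
  `ε`-cap contains an `ε`-neck** (`IsCkEpsCap.exists_isCkEpsNeck`; used when alternative (b) of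
  the canonical neighbourhood theorem is to produce a neck).
* Scale covariance: `neckPullback_constSmul`, `isCkEpsNeck_constSmul_iff` (an `ε`-neck of radius
  `r` of `g` is one of radius `√a r` of `a g`), `isCkEpsCap_constSmul_iff` (caps of `g` and `a g`
  coincide), the `C^k` siblings of `isEpsNeck_constSmul_iff` / `isEpsCap_constSmul_iff`
  (`NeckScaling.lean`).
* Non-vacuity, the model case (all proved): dilations `x ↦ a x` of `ℝᵐ⁺¹` are neck charts
  (`isNeckChart_smul`) along which the standard cylinder `ḡ = c|x|⁻²δ` pulls back to itself
  (`neckPullback_cylMetricReg_smul`: `ḡ` is dilation invariant), so that in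
  `(ℝ⁴, cylMetricReg 3 (2ε⁻¹))` — Chen–Zhu's standard cylinder `S³(√6) × ℝ` in the conformal
  model, regularised across the origin: a **capped half-cylinder** — the open unit ball `𝔹⁴` is an
  `ε`-cap in the `C^{[1/ε]}` topology for its Levi-Civita connection
  (`isCkEpsCap_openBall_cylMetricReg`): off the closed ball of radius `q²`, `q = e^{-ε⁻¹/√6}`,
  every point lies in the single `ε`-neck `{q² < |x| < 1} = q · A(ε⁻¹)` of radius `1`, and `R` is
  bounded on `𝔹⁴` by continuity on the compact closed ball.

## References

* B.-L. Chen, X.-P. Zhu, *Ricci flow with surgery on four-manifolds with positive isotropic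
  curvature*, J. Differential Geom. 74 (2006) 177–264 (arXiv:math/0504478): §2, p. 4 (ε-necks,
  "`(N, r⁻²g)` is `ε`-close, in `C^{[ε⁻¹]}` topology, to a standard neck"); §4, p. 24 (ε-caps);
  Thm. 4.1 (p. 19); §5, p. 26 (canonical neighbourhood assumption, (b)). [ChenZhu2006]
* R. S. Hamilton, *Four-manifolds with positive isotropic curvature*, Comm. Anal. Geom. 5 (1997)
  1–92: §3.2 (C2), p. 31, (A)–(B) (`C^k`-closeness of necks). [Hamilton1997]
* B. O'Neill, *Semi-Riemannian geometry* (1983), Ch. 3, Thm. 3.11, Def. 3.53 (Levi-Civita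
  connection; scalar curvature, continuous). [ONeill1983]
-/

noncomputable section

open Bundle Set Metric Module TopologicalSpace Function
open scoped Manifold ContDiff Topology RealInnerProductSpace

namespace Literature.Geometry.Riemannian

open Lorentzian Lorentzian.PseudoRiemannianMetric
open Literature.Topology.FourManifolds

/-- Local notation: `𝔼 n` is the model Euclidean space `EuclideanSpace ℝ (Fin n)`. -/
local notation "𝔼 " n:arg => EuclideanSpace ℝ (Fin n)

/-- Local notation: `𝔽 m = ℝᵐ⁺¹`, the vector space containing the model necks (`CkNecks.lean`). -/
local notation "𝔽 " m:arg => EuclideanSpace ℝ (Fin (m + 1))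

/-- Local notation: the standard unit `n`-sphere `𝕊 n ⊂ ℝⁿ⁺¹`. -/
local notation "𝕊 " n:arg => (Metric.sphere (0 : EuclideanSpace ℝ (Fin (n + 1))) 1)

/-! ### The model caps `𝔹ⁿ` and `ℝℙⁿ ∖ 𝔹̄ⁿ` are not compact -/

section Models

/-- The open unit ball of `ℝⁿ`, `n ≥ 1`, is not compact: a compact subset of a Hausdorff space is
closed, but the closure of the open unit ball is the closed unit ball, which contains unit
vectors. [folklore] -/
theorem not_isCompact_unitBall (n : ℕ) [NeZero n] : ¬ IsCompact (Metric.ball (0 : 𝔼 n) 1) := by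
  intro h
  have hcl : closure (Metric.ball (0 : 𝔼 n) 1) = Metric.ball 0 1 := h.isClosed.closure_eq
  rw [closure_ball (0 : 𝔼 n) one_ne_zero] at hcl
  have hmem : EuclideanSpace.single (0 : Fin n) (1 : ℝ) ∈ Metric.closedBall (0 : 𝔼 n) 1 := by
    simp
  rw [hcl, mem_ball_zero_iff] at hmem
  simp at hmem

/-- The model cap `𝔹ⁿ = openBall n` (`n ≥ 1`) is not a compact space. [folklore] -/
theorem not_compactSpace_openBall (n : ℕ) [NeZero n] : ¬ CompactSpace (openBall n) :=
  fun h ↦ not_isCompact_unitBall n (isCompact_iff_compactSpace.2 h)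

/-- `ℝℙⁿ ∖ 𝔹̄ⁿ` (`n ≥ 1`) is not compact: otherwise it would be a clopen subset of `ℝℙⁿ` whose
preimage in the connected sphere `𝕊ⁿ` is clopen, hence empty or everything; but the class of an
equatorial point `e_n` belongs to it (neither `± e_n` lies in the polar cap `{y₀ ≥ 1/2}`) while the
class of the pole `e₀` does not. [folklore] -/
theorem not_isCompact_coe_puncturedRealProjectiveSpace (n : ℕ) [NeZero n] :
    ¬ IsCompact ((puncturedRealProjectiveSpace n : Opens (RealProjectiveSpace n)) :
      Set (RealProjectiveSpace n)) := by
  intro hK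
  have hn : n ≠ 0 := NeZero.ne n
  set U : Set (RealProjectiveSpace n) :=
    ((puncturedRealProjectiveSpace n : Opens (RealProjectiveSpace n)) : Set (RealProjectiveSpace n))
    with hU
  have hcont : Continuous (RealProjectiveSpace.mk n) := (RealProjectiveSpace.contMDiff_mk n).continuous
  have hclopen : IsClopen (RealProjectiveSpace.mk n ⁻¹' U) :=
    ⟨hK.isClosed.preimage hcont, (puncturedRealProjectiveSpace n).isOpen.preimage hcont⟩
  -- the sphere `𝕊ⁿ`, `n ≥ 1`, is (pre)connected
  haveI : PreconnectedSpace (𝕊 n) := by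
    refine isPreconnected_iff_preconnectedSpace.1
      (isConnected_sphere ?_ (0 : 𝔼 (n + 1)) zero_le_one).isPreconnected
    rw [← Module.finrank_eq_rank, finrank_euclideanSpace_fin]
    exact_mod_cast (show 1 < n + 1 by omega)
  -- the pole and an equatorial point of the sphere
  set e₀ : 𝕊 n := ⟨EuclideanSpace.single (0 : Fin (n + 1)) (1 : ℝ),
    mem_sphere_zero_iff_norm.2 (by simp)⟩ with he₀
  set e₁ : 𝕊 n := ⟨EuclideanSpace.single (Fin.last n) (1 : ℝ),
    mem_sphere_zero_iff_norm.2 (by simp)⟩ with he₁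
  have hlast : (0 : Fin (n + 1)) ≠ Fin.last n := by
    intro h
    have h' := congrArg Fin.val h
    simp only [Fin.val_zero, Fin.val_last] at h'
    exact hn h'.symm
  have h₀ : ((e₀ : 𝕊 n) : 𝔼 (n + 1)) 0 = 1 := by
    simp [he₀]
  have h₁ : ((e₁ : 𝕊 n) : 𝔼 (n + 1)) 0 = 0 := by
    simp [he₁, hlast]
  rcases isClopen_iff.1 hclopen with hempty | huniv
  · -- the class of the equatorial point lies in `U`
    have hmem : RealProjectiveSpace.mk n e₁ ∈ U := by
      rw [hU, SetLike.mem_coe, mem_puncturedRealProjectiveSpace]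
      intro y hy hye
      have hy' : (1 / 2 : ℝ) ≤ (y : 𝔼 (n + 1)) 0 := hy
      rcases (RealProjectiveSpace.mk_eq_mk_iff y e₁).1 hye with h | h
      · have := congrArg (fun z : 𝕊 n ↦ (z : 𝔼 (n + 1)) 0) h
        simp only [h₁] at this
        linarith
      · have := congrArg (fun z : 𝕊 n ↦ (z : 𝔼 (n + 1)) 0) h
        simp only [h₁, coe_neg_sphere, PiLp.neg_apply] at this
        linarith
    have : e₁ ∈ RealProjectiveSpace.mk n ⁻¹' U := hmem
    rw [hempty] at this
    exact this
  · -- the class of the pole does not lie in `U`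
    have he₀cap : e₀ ∈ polarCap n := by
      show (1 / 2 : ℝ) ≤ (e₀ : 𝔼 (n + 1)) 0
      rw [h₀]; norm_num
    have hnot : RealProjectiveSpace.mk n e₀ ∉ U := by
      rw [hU, SetLike.mem_coe, mem_puncturedRealProjectiveSpace]
      exact fun hall ↦ hall e₀ he₀cap rfl
    have : e₀ ∈ RealProjectiveSpace.mk n ⁻¹' U := by rw [huniv]; exact mem_univ _
    exact hnot this

/-- The model cap `ℝℙⁿ ∖ 𝔹̄ⁿ = puncturedRealProjectiveSpace n` (`n ≥ 1`) is not a compact space.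
[folklore] -/
theorem not_compactSpace_puncturedRealProjectiveSpace (n : ℕ) [NeZero n] :
    ¬ CompactSpace (puncturedRealProjectiveSpace n) :=
  fun h ↦ not_isCompact_coe_puncturedRealProjectiveSpace n (isCompact_iff_compactSpace.2 h)

end Models

/-! ### `ε`-caps in the `C^{[1/ε]}` topology -/

section Cap

variable {M : Type*} [TopologicalSpace M] [ChartedSpace (𝔼 4) M] [IsManifold (𝓡 4) ∞ M]

/-- **`B` is an `ε`-cap of `(M⁴, g)` in the `C^{[1/ε]}` topology** (Chen–Zhu 2006, §4, arXiv p. 24: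
"A metric on `𝔹⁴` or `ℝℙ⁴ ∖ 𝔹̄⁴`, such that each point outside some compact subset is contained
in an `ε`-neck, is called an `ε`-cap … if the scalar curvature stays bounded … on the end", the
`ε`-necks being those of §2, p. 4: "`(N, r⁻²g)` is `ε`-close, in `C^{[ε⁻¹]}` topology, to a
standard neck"), for an open `B ⊆ M` with the induced metric: `ε > 0`; `B` is diffeomorphic to
the open ball `𝔹⁴` (`openBall 4`) or to `ℝℙ⁴ ∖ 𝔹̄⁴` (`puncturedRealProjectiveSpace 4`); there is
a compact `K ⊆ B` such that every point of `B ∖ K` lies in an `ε`-neck of `(M, g)` **in the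
`C^{[ε⁻¹]}` topology** (`IsCkEpsNeck 3 g N ε r` of `CkNecks.lean`: Hamilton's conditions (A), (B)
with `k = [ε⁻¹]`, some radius `r > 0`) contained in `B`; and the scalar curvature
`R = scalarCurvatureWith g cov` of the pair `(g, cov)` (`cov` a Levi-Civita witness, as in the
Ricci-flow layer) is bounded on `B`. The faithful sibling of the `C⁰` notion `IsEpsCap`
(`CanonicalNeighbourhoods.lean`), with the same signature. [cite: ChenZhu2006, §4, p. 24]
[cite: ChenZhu2006, §2, p. 4] -/
structure IsCkEpsCap (g : PseudoRiemannianMetric (𝓡 4) ∞ (𝔼 4) (TangentSpace (𝓡 4) : M → Type _))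
    (cov : CovariantDerivative (𝓡 4) (𝔼 4) (TangentSpace (𝓡 4) : M → Type _))
    (B : Opens M) (ε : ℝ) : Prop where
  /-- The accuracy is positive. -/
  eps_pos : 0 < ε
  /-- `B` is diffeomorphic to `𝔹⁴` or to `ℝℙ⁴ ∖ 𝔹̄⁴`. -/
  topology : Nonempty (B ≃ₘ⟮𝓡 4, 𝓡 4⟯ openBall 4) ∨
    Nonempty (B ≃ₘ⟮𝓡 4, 𝓡 4⟯ puncturedRealProjectiveSpace 4)
  /-- Outside a compact subset, every point of `B` lies in an `ε`-neck (in the `C^{[1/ε]}`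
  topology) inside `B`. -/
  exists_isCompact : ∃ K : Set M, IsCompact K ∧ K ⊆ B ∧
    ∀ x ∈ (B : Set M), x ∉ K → ∃ (N : Set M) (r : ℝ), N ⊆ B ∧ x ∈ N ∧ IsCkEpsNeck 3 g N ε r
  /-- The scalar curvature stays bounded on `B`. -/
  exists_bound : ∃ C : ℝ, ∀ x ∈ (B : Set M), |g.scalarCurvatureWith cov x| ≤ C

variable {g : PseudoRiemannianMetric (𝓡 4) ∞ (𝔼 4) (TangentSpace (𝓡 4) : M → Type _)}
  {cov : CovariantDerivative (𝓡 4) (𝔼 4) (TangentSpace (𝓡 4) : M → Type _)} {B : Opens M} {ε : ℝ}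

/-- **An `ε`-cap is not compact** (it is diffeomorphic to `𝔹⁴` or to `ℝℙ⁴ ∖ 𝔹̄⁴`).
[cite: ChenZhu2006, §4, p. 24] -/
theorem IsCkEpsCap.not_compactSpace (h : IsCkEpsCap g cov B ε) : ¬ CompactSpace B := by
  intro hB
  rcases h.topology with hB' | hB'
  · exact not_compactSpace_openBall 4 hB'.some.toHomeomorph.compactSpace
  · exact not_compactSpace_puncturedRealProjectiveSpace 4 hB'.some.toHomeomorph.compactSpace

/-- An `ε`-cap is not a compact subset of `M`. [cite: ChenZhu2006, §4, p. 24] -/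
theorem IsCkEpsCap.not_isCompact (h : IsCkEpsCap g cov B ε) : ¬ IsCompact (B : Set M) :=
  fun hB ↦ h.not_compactSpace (isCompact_iff_compactSpace.1 hB)

/-- An `ε`-cap is not exhausted by any compact subset: for every compact `K ⊆ B` there is a point
of `B` outside `K` (so the neck condition is never vacuous). [cite: ChenZhu2006, §4, p. 24] -/
theorem IsCkEpsCap.exists_not_mem (h : IsCkEpsCap g cov B ε) {K : Set M} (hK : IsCompact K)
    (hKB : K ⊆ B) : ∃ x ∈ (B : Set M), x ∉ K := by
  by_contra hcon
  have hBK : (B : Set M) ⊆ K := fun x hx ↦ by_contra fun hxK ↦ hcon ⟨x, hx, hxK⟩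
  have heq : (B : Set M) = K := Subset.antisymm hBK hKB
  apply h.not_isCompact
  rw [heq]
  exact hK

/-- **Every `ε`-cap contains an `ε`-neck** (in the `C^{[1/ε]}` topology): the cap is not compact,
so it has points off the compact subset outside of which every point lies in an `ε`-neck inside the
cap. [cite: ChenZhu2006, §4, p. 24] -/
theorem IsCkEpsCap.exists_isCkEpsNeck (h : IsCkEpsCap g cov B ε) :
    ∃ (N : Set M) (r : ℝ), N ⊆ B ∧ IsCkEpsNeck 3 g N ε r := by
  obtain ⟨K, hK, hKB, hneck⟩ := h.exists_isCompact
  obtain ⟨x, hx, hxK⟩ := h.exists_not_mem hK hKB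
  obtain ⟨N, r, hNB, -, hN⟩ := hneck x hx hxK
  exact ⟨N, r, hNB, hN⟩

/-- An `ε`-cap is nonempty (it contains a neck, which is nonempty). [folklore] -/
theorem IsCkEpsCap.nonempty (h : IsCkEpsCap g cov B ε) : (B : Set M).Nonempty := by
  obtain ⟨N, r, hNB, hN⟩ := h.exists_isCkEpsNeck
  exact hN.nonempty.mono hNB

end Cap

/-! ### Scale covariance of `C^k` necks and caps -/

section NeckScaling

variable {E : Type*} [NormedAddCommGroup E] [NormedSpace ℝ E] {H : Type*} [TopologicalSpace H]
  {I : ModelWithCorners ℝ E H} {M : Type*} [TopologicalSpace M] [ChartedSpace H M]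
  [IsManifold I ∞ M] {m : ℕ}

/-- The pulled-back tensor of a rescaled metric: `c · ψ^*(a g) = (c a) · ψ^* g`. [folklore] -/
theorem neckPullback_constSmul (g : PseudoRiemannianMetric I ∞ E (TangentSpace I : M → Type _))
    {a : ℝ} (ha : a ≠ 0) (c : ℝ) (ψ : 𝔽 m → M) :
    neckPullback (g.constSmul a ha) c ψ = neckPullback g (c * a) ψ := by
  funext x v
  simp only [neckPullback_apply, constSmul_apply, mul_assoc]

/-- **`C^k` `ε`-necks under rescaling**: `N` is an `ε`-neck of radius `√a · r` of `(M, a g)` in the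
`C^{[1/ε]}` topology iff it is an `ε`-neck of radius `r` of `(M, g)` (Chen–Zhu 2006, §2, p. 4: the
neck condition is on `r⁻² g`, and `(√a r)⁻² (a g) = r⁻² g`). The `C^k` sibling of
`isEpsNeck_constSmul_iff`. [cite: ChenZhu2006, §2, p. 4] -/
theorem isCkEpsNeck_constSmul_iff {g : PseudoRiemannianMetric I ∞ E (TangentSpace I : M → Type _)}
    {N : Set M} {ε r a : ℝ} (ha : 0 < a) :
    IsCkEpsNeck m (g.constSmul a ha.ne') N ε (Real.sqrt a * r) ↔ IsCkEpsNeck m g N ε r := by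
  have hsa : 0 < Real.sqrt a := Real.sqrt_pos.mpr ha
  constructor
  · rintro ⟨⟨hε, hr⟩, ψ, hψ, hclose⟩
    refine ⟨⟨hε, (mul_pos_iff_of_pos_left hsa).mp hr⟩, ψ, hψ, ?_⟩
    rwa [neckPullback_constSmul, inv_sqrt_mul_sq_mul ha] at hclose
  · rintro ⟨⟨hε, hr⟩, ψ, hψ, hclose⟩
    refine ⟨⟨hε, mul_pos hsa hr⟩, ψ, hψ, ?_⟩
    rwa [neckPullback_constSmul, inv_sqrt_mul_sq_mul ha]

end NeckScaling

section CapScaling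

variable {M : Type*} [TopologicalSpace M] [ChartedSpace (𝔼 4) M] [IsManifold (𝓡 4) ∞ M]

/-- **`C^k` `ε`-caps are scale-invariant** (`a > 0`): the topology of `B` is metric-free, the
necks of `a g` covering the end are the necks of `g` with radii multiplied by `√a`
(`isCkEpsNeck_constSmul_iff`), and `|R(a g)| = a⁻¹ |R(g)|` stays bounded on `B`. The `C^k`
sibling of `isEpsCap_constSmul_iff`. [cite: ChenZhu2006, §4, p. 24] -/
theorem isCkEpsCap_constSmul_iff
    {g : PseudoRiemannianMetric (𝓡 4) ∞ (𝔼 4) (TangentSpace (𝓡 4) : M → Type _)}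
    {cov : CovariantDerivative (𝓡 4) (𝔼 4) (TangentSpace (𝓡 4) : M → Type _)}
    {B : Opens M} {ε a : ℝ} (ha : 0 < a) :
    IsCkEpsCap (g.constSmul a ha.ne') cov B ε ↔ IsCkEpsCap g cov B ε := by
  have hsa : Real.sqrt a ≠ 0 := (Real.sqrt_pos.mpr ha).ne'
  have hR : ∀ x, (g.constSmul a ha.ne').scalarCurvatureWith cov x =
      a⁻¹ * g.scalarCurvatureWith cov x :=
    fun x ↦ scalarCurvatureWith_constSmul g a ha.ne' cov x
  constructor
  · rintro ⟨hε, htop, ⟨K, hK, hKB, hneck⟩, ⟨C, hC⟩⟩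
    refine ⟨hε, htop, ⟨K, hK, hKB, fun x hx hxK ↦ ?_⟩, ⟨a * C, fun x hx ↦ ?_⟩⟩
    · obtain ⟨N, r, hNB, hxN, hN⟩ := hneck x hx hxK
      refine ⟨N, r / Real.sqrt a, hNB, hxN, (isCkEpsNeck_constSmul_iff ha).mp ?_⟩
      rwa [mul_div_cancel₀ _ hsa]
    · have h := hC x hx
      rw [hR, abs_mul, abs_inv, abs_of_pos ha, inv_mul_le_iff₀ ha] at h
      exact h
  · rintro ⟨hε, htop, ⟨K, hK, hKB, hneck⟩, ⟨C, hC⟩⟩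
    refine ⟨hε, htop, ⟨K, hK, hKB, fun x hx hxK ↦ ?_⟩, ⟨a⁻¹ * C, fun x hx ↦ ?_⟩⟩
    · obtain ⟨N, r, hNB, hxN, hN⟩ := hneck x hx hxK
      exact ⟨N, Real.sqrt a * r, hNB, hxN, (isCkEpsNeck_constSmul_iff ha).mpr hN⟩
    · rw [hR, abs_mul, abs_inv, abs_of_pos ha]
      exact mul_le_mul_of_nonneg_left (hC x hx) (inv_nonneg.mpr ha.le)

end CapScaling

/-! ### Non-vacuity: the capped half-cylinder -/

section Model

variable {m : ℕ}

/-- The differential of a dilation is the dilation. [folklore] -/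
theorem mfderiv_smul_apply (a : ℝ) (x w : 𝔽 m) :
    mfderiv 𝓘(ℝ, 𝔽 m) 𝓘(ℝ, 𝔽 m) (fun y : 𝔽 m ↦ a • y) x w = (a • w : 𝔽 m) := by
  have h : HasFDerivAt (fun y : 𝔽 m ↦ a • y) (a • ContinuousLinearMap.id ℝ (𝔽 m)) x :=
    (hasFDerivAt_id x).const_smul a
  rw [mfderiv_eq_fderiv, h.fderiv]
  rfl

/-- **Dilations are neck charts**: for `a ≠ 0` the dilation `x ↦ a x` of `ℝᵐ⁺¹` is a neck chart of
half-length `L` of the model neck `A(L)` onto the dilated annulus `a · A(L)` (in `M = ℝᵐ⁺¹`):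
smooth, injective, open, immersive. [folklore] -/
theorem isNeckChart_smul (m : ℕ) (L : ℝ) {a : ℝ} (ha : a ≠ 0) :
    IsNeckChart 𝓘(ℝ, 𝔽 m) m L (fun x : 𝔽 m ↦ a • x)
      ((fun x : 𝔽 m ↦ a • x) '' neckAnnulus m L) where
  contMDiffOn := (contDiff_const_smul a).contMDiff.contMDiffOn
  injOn := (smul_right_injective (𝔽 m) ha).injOn
  image_eq := rfl
  isOpen_image U hU _ := isOpenMap_smul₀ ha U hU
  injective_mfderiv x _ := by
    intro v w hvw
    have h' : (a • v : 𝔽 m) = a • w := by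
      have := hvw
      rwa [mfderiv_smul_apply, mfderiv_smul_apply] at this
    exact smul_right_injective (𝔽 m) ha h'

/-- A dilated point of a model neck is non-zero. [folklore] -/
theorem norm_ne_zero_of_smul_mem_neckAnnulus {L a : ℝ} {x : 𝔽 m} (hx : a • x ∈ neckAnnulus m L) :
    ‖x‖ ≠ 0 := by
  intro h0
  have := norm_pos_of_mem_neckAnnulus hx
  rw [norm_smul, h0, mul_zero] at this
  exact lt_irrefl _ this

/-- **The standard cylinder is dilation invariant**: along the dilation `x ↦ a x`, at the points
`x` with `a x` in the model neck `A(L')` (where `cylMetricReg m L'` is `ḡ = c|x|⁻²δ`), the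
pull-back of the regularised cylinder at scale `1` is `ḡ` itself:
`ḡ_{ax}(a v, a w) = c |a x|⁻² a² ⟨v, w⟩ = ḡ_x(v, w)` (the dilations of `ℝᵐ⁺¹ ∖ 0` are the
translations along the axis of the cylinder `Sᵐ × ℝ`). [folklore] -/
theorem neckPullback_cylMetricReg_smul {L' a : ℝ} (ha : a ≠ 0) {x : 𝔽 m}
    (hx : a • x ∈ neckAnnulus m L') :
    neckPullback (I := 𝓘(ℝ, 𝔽 m)) (cylMetricReg m L') 1 (fun y : 𝔽 m ↦ a • y) x = cylTensor m x := by
  have hx0 : ‖x‖ ≠ 0 := norm_ne_zero_of_smul_mem_neckAnnulus hx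
  funext v
  simp only [neckPullback_apply, one_mul, mfderiv_smul_apply]
  change neckScale m * (radialReg m L' (‖a • x‖ ^ 2))⁻¹ *
    (euclideanMetric (𝔽 m)).val (a • x) (a • v 0) (a • v 1) = _
  rw [euclideanMetric_apply, radialReg_norm_sq hx]
  change neckScale m * (‖a • x‖ ^ 2)⁻¹ * ⟪(a • v 0 : 𝔽 m), (a • v 1 : 𝔽 m)⟫ =
    neckScale m * (‖x‖ ^ 2)⁻¹ * ⟪v 0, v 1⟫
  rw [norm_smul, real_inner_smul_left, real_inner_smul_right, Real.norm_eq_abs, mul_pow, sq_abs]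
  field_simp

/-- The dilation by the inner radius `q = e^{-L/√c}` carries the model neck `A(L)` into the model
neck `A(2L)` (onto the annulus `{q² < |x| < 1}`), for `L ≥ 0`. [folklore] -/
theorem smul_mem_neckAnnulus_two_mul {L : ℝ} (hL : 0 ≤ L) {y : 𝔽 m} (hy : y ∈ neckAnnulus m L) :
    Real.exp (-(L / Real.sqrt (neckScale m))) • y ∈ neckAnnulus m (2 * L) := by
  set q : ℝ := Real.exp (-(L / Real.sqrt (neckScale m))) with hq
  have hq0 : 0 < q := Real.exp_pos _
  have hqinv : Real.exp (L / Real.sqrt (neckScale m)) = q⁻¹ := by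
    rw [hq, Real.exp_neg, inv_inv]
  have hq2 : Real.exp (-(2 * L / Real.sqrt (neckScale m))) = q * q := by
    rw [hq, ← Real.exp_add]; congr 1; ring
  have hnn : 0 ≤ 2 * L / Real.sqrt (neckScale m) := div_nonneg (by linarith) (Real.sqrt_nonneg _)
  refine ⟨?_, ?_⟩
  · rw [norm_smul, Real.norm_of_nonneg hq0.le, hq2]
    exact mul_lt_mul_of_pos_left hy.1 hq0
  · rw [norm_smul, Real.norm_of_nonneg hq0.le]
    have h1 : q * ‖y‖ < 1 := by
      have := mul_lt_mul_of_pos_left hy.2 hq0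
      rwa [hqinv, mul_inv_cancel₀ hq0.ne'] at this
    exact h1.trans_le (Real.one_le_exp hnn)

/-- **Non-vacuity / the model case: the capped half-cylinder.** In `(ℝ⁴, cylMetricReg 3 (2ε⁻¹))`
— the smooth Riemannian metric `(6/ρ(|x|²)) δ` which is Chen–Zhu's standard cylinder
`ḡ = 6|x|⁻²δ ≅ S³(√6) × ℝ` (scalar curvature `1`) on the model neck
`A(2ε⁻¹) = {q² < |x| < q⁻²}`, `q = e^{-ε⁻¹/√6}`, and is capped off smoothly across the origin —
the open unit ball `𝔹⁴` is an
`ε`-cap in the `C^{[1/ε]}` topology, for every Levi-Civita connection `cov` of the metric (there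
is exactly one, `g.leviCivita` under `g.hasLeviCivita`, by `isLeviCivita_leviCivita_holds`):
`B = 𝔹⁴ ≅ 𝔹⁴` by the identity; off the compact ball `K = {|x| ≤ q²} ⊆ 𝔹⁴` every point lies in the
`ε`-neck `N = q · A(ε⁻¹) = {q² < |x| < 1} ⊆ 𝔹⁴` of radius `1` (chart: the dilation by `q`, along
which `ḡ` pulls back to `ḡ`, so all differences and covariant derivatives vanish); and the scalar
curvature, continuous (O'Neill 1983, Def. 3.53; `IsLeviCivita.continuous_trace_ricci_of_two_le`),
is bounded on the compact closed unit ball. [cite: ChenZhu2006, §4, p. 24] -/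
theorem isCkEpsCap_openBall_cylMetricReg {ε : ℝ} (hε : 0 < ε)
    {cov : CovariantDerivative (𝓡 4) (𝔼 4) (TangentSpace (𝓡 4) : 𝔼 4 → Type _)}
    (hcov : PseudoRiemannianMetric.IsLeviCivita (I := 𝓡 4) (M := 𝔼 4)
      (cylMetricReg 3 (2 * ε⁻¹)) cov) :
    IsCkEpsCap (M := 𝔼 4) (cylMetricReg 3 (2 * ε⁻¹)) cov (openBall 4) ε := by
  have hL : 0 < ε⁻¹ := inv_pos.2 hε
  set q : ℝ := Real.exp (-(ε⁻¹ / Real.sqrt (neckScale 3))) with hq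
  have hq0 : 0 < q := Real.exp_pos _
  have hq1 : q < 1 :=
    Real.exp_lt_one_iff.mpr (neg_lt_zero.mpr (div_pos hL (Real.sqrt_pos.2 (neckScale_pos 3))))
  have hqq : q ^ 2 < 1 := by nlinarith
  have hqinv : Real.exp (ε⁻¹ / Real.sqrt (neckScale 3)) = q⁻¹ := by
    rw [hq, Real.exp_neg, inv_inv]
  refine ⟨hε, Or.inl ⟨Diffeomorph.refl (𝓡 4) (openBall 4) ∞⟩, ?_, ?_⟩
  · -- the necks covering the end `{q² < |x| < 1}`
    refine ⟨Metric.closedBall (0 : 𝔼 4) (q ^ 2), isCompact_closedBall _ _,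
      Metric.closedBall_subset_ball hqq, fun x hx hxK ↦ ?_⟩
    have hx1 : ‖x‖ < 1 := mem_ball_zero_iff.mp hx
    have hx2 : q ^ 2 < ‖x‖ := by simpa [mem_closedBall_zero_iff] using hxK
    refine ⟨(fun y : 𝔽 3 ↦ q • y) '' neckAnnulus 3 ε⁻¹, 1, ?_, ?_, ?_⟩
    · -- `N ⊆ 𝔹⁴`
      rintro _ ⟨y, hy, rfl⟩
      show q • y ∈ Metric.ball (0 : 𝔼 4) 1
      rw [mem_ball_zero_iff, norm_smul, Real.norm_of_nonneg hq0.le]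
      have := mul_lt_mul_of_pos_left hy.2 hq0
      rwa [hqinv, mul_inv_cancel₀ hq0.ne'] at this
    · -- `x ∈ N`: `x = q (q⁻¹ x)` with `q⁻¹ x ∈ A(ε⁻¹)`
      refine ⟨q⁻¹ • x, ⟨?_, ?_⟩, by simp only [smul_smul, mul_inv_cancel₀ hq0.ne', one_smul]⟩
      · rw [norm_smul, norm_inv, Real.norm_of_nonneg hq0.le, ← hq, lt_inv_mul_iff₀ hq0]
        nlinarith
      · rw [norm_smul, norm_inv, Real.norm_of_nonneg hq0.le, hqinv]
        exact mul_lt_of_lt_one_right (inv_pos.2 hq0) hx1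
    · -- `N` is an `ε`-neck of radius `1` in the `C^{[1/ε]}` topology
      refine ⟨⟨hε, one_pos⟩, fun y : 𝔽 3 ↦ q • y, isNeckChart_smul 3 ε⁻¹ hq0.ne', ?_⟩
      simp only [inv_one, one_pow]
      exact isCkCloseOn_of_eqOn (isOpen_neckAnnulus 3 ε⁻¹) hε fun y hy ↦
        neckPullback_cylMetricReg_smul hq0.ne' (smul_mem_neckAnnulus_two_mul hL.le hy)
  · -- the scalar curvature is bounded on `𝔹⁴` (continuous on the compact closed ball)
    have hcont : Continuous fun x : 𝔼 4 ↦ (cylMetricReg 3 (2 * ε⁻¹)).scalarCurvatureWith cov x :=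
      hcov.continuous_trace_ricci_of_two_le
        (by simpa using (WithTop.coe_le_coe.2 le_top : ((2 : ℕ∞) : ℕ∞ω) ≤ ∞))
    obtain ⟨C, hC⟩ :=
      (isCompact_closedBall (0 : 𝔼 4) 1).exists_bound_of_continuousOn hcont.continuousOn
    refine ⟨C, fun x hx ↦ ?_⟩
    have h := hC x (Metric.ball_subset_closedBall hx)
    rwa [Real.norm_eq_abs] at h

/-- The model cap for the Levi-Civita connection proper: `𝔹⁴ ⊂ (ℝ⁴, cylMetricReg 3 (2ε⁻¹))` is an
`ε`-cap in the `C^{[1/ε]}` topology for `g.leviCivita`. [cite: ChenZhu2006, §4, p. 24] -/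
theorem isCkEpsCap_openBall_cylMetricReg_leviCivita {ε : ℝ} (hε : 0 < ε) :
    haveI := PseudoRiemannianMetric.hasLeviCivita (I := 𝓡 4) (M := 𝔼 4) (cylMetricReg 3 (2 * ε⁻¹))
    IsCkEpsCap (M := 𝔼 4) (cylMetricReg 3 (2 * ε⁻¹))
      (PseudoRiemannianMetric.leviCivita (I := 𝓡 4) (M := 𝔼 4) (cylMetricReg 3 (2 * ε⁻¹)))
      (openBall 4) ε :=
  haveI := PseudoRiemannianMetric.hasLeviCivita (I := 𝓡 4) (M := 𝔼 4) (cylMetricReg 3 (2 * ε⁻¹))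
  isCkEpsCap_openBall_cylMetricReg hε isLeviCivita_leviCivita_holds

end Model

end Literature.Geometry.Riemannian

end
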